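import Literature.Topology.FourManifolds.SimplifiedBrokenLefschetzRoundCritical
import Literature.Topology.FourManifolds.KnotsProofs
import Literature.Topology.FourManifolds.KnotFraming
import Literature.Topology.FourManifolds.ImmersionCriterion
import HarnessLib

/-!
# The round locus of a simplified broken Lefschetz fibration is a smoothly embedded circle,
# parametrised by the longitude of its image

Topic `Literature/Topology/FourManifolds`; groundwork for the structure of an SBLF near its round
circle (Auroux–Donaldson–Katzarkov 2005, §8.1; Baykur–Kamada 2015, §2 and §5 ¶1: *"the round
cobordism … is a fibrewise handle attachment along the round singular circle"*), written for the
fact seat of `nonempty_diffeomorph_sphere_four_of_sblf_genus_one_noLefschetz`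
(`SimplifiedBrokenLefschetzFibration.lean`).  Everything here is **proved**; there are no
definitions and no named facts.

Let `f : X → S²` be an SBLF on a closed 4-manifold whose round image is the equator
`E = {y | y₂ = 0}` (`IsSimplifiedBrokenLefschetzFibration.exists_image_round_eq_sphereEquator`),
`Z = {df not onto} ∖ L` its round locus.

* `SphereGerm.fderiv_single_zero_eq_smul` — in a fold chart at a round point `q` (Hayano 2011,
  Def. 2.1 (4)) the base germ `Γ = ψ⁻¹ : ℝ² → S² ⊆ ℝ³` carries the axis into `E`; **its axis
  derivative `∂ₜΓ(0)` is a non-zero multiple of the unit tangent `T = (-y₁, y₀, 0)` of the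
  equator at `y = f q`** (it is non-zero, horizontal and tangent to the sphere).
* `IsSimplifiedBrokenLefschetzFibration.isMCriticalPt_height_comp_iff_of_round_of_equator` —
  hence **a round point `q` is a critical point of the height `⟪a, ·⟫ ∘ f` iff `a ⊥ T(f q)`**,
  i.e. iff `a₁ (f q)₀ = a₀ (f q)₁` (for every `a ∈ ℝ³`; the tree had the case `a = (a₀, 0, a₂)`,
  `isMCriticalPt_height_comp_iff_of_round`), and in particular the tangential height
  `⟪T(f q), ·⟫ ∘ f` is regular at `q`
  (`not_isMCriticalPt_tangentHeight_comp_of_round`): the meridian discs of `S²` are transverse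
  to `f` along `Z`.
* `IsSimplifiedBrokenLefschetzFibration.exists_isSmoothEmbedding_range_eq_round` — **the round
  locus is a smoothly embedded circle parametrised by longitude**: there is a `C^∞` embedding
  `e : S¹ ↪ X` with `range e = Z` and `f (e u) = (u₀, u₁, 0)` (the standard inclusion
  `sphereInclusion 1 2`) for every `u ∈ S¹`.  Since `f` is injective on the critical set
  (Hayano 2011, Def. 2.1 (5)) and `f(Z) = E`, `e` is the inverse of `f|_Z` composed with the
  equator; it is continuous because `f|_Z` is a closed embedding of the compact `Z`, smooth
  because in a fold chart `φ` at `e u₀` it reads `u ↦ φ⁻¹((ψ (u₀, u₁, 0))₀, 0, 0, 0)`, an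
  immersion because `f ∘ e` is, hence an embedding (Hirsch 1976, Ch. 1 §3 Thm. 3.1, the tree's
  `isSmoothEmbedding_of_injective_of_injective_mfderiv`).

## References

* D. Auroux, S. K. Donaldson, L. Katzarkov, *Singular Lefschetz pencils*, Geom. Topol. 9 (2005),
  §8.1. [AurouxDonaldsonKatzarkov2005]
* R. İ. Baykur, S. Kamada, *Classification of broken Lefschetz fibrations with small fiber
  genera*, J. Math. Soc. Japan 67 (2015), §2, §3, §5. [BaykurKamada2015]
* K. Hayano, *On genus-1 simplified broken Lefschetz fibrations*, Algebr. Geom. Topol. 11 (2011),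
  Def. 2.1 (4), (5). [Hayano2011]
* M. W. Hirsch, *Differential Topology* (1976), Ch. 1 §3 Thm. 3.1. [HirschDT1976]
-/

noncomputable section

open scoped Manifold ContDiff Topology RealInnerProductSpace
open Set Function Filter Metric

namespace Literature.Topology.FourManifolds

universe u

/-! ### The tangent of the round image in a fold chart -/

namespace SphereGerm

variable {Γ : EuclideanSpace ℝ (Fin 2) → EuclideanSpace ℝ (Fin 3)}

/-- **The axis derivative of the base germ is tangent to the equator.**  For a `C²` germ
`Γ : ℝ² → S² ⊆ ℝ³` at `0` carrying the axis `{(t, 0)}` into the equator `{y₂ = 0}`, with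
injective differential at `0`: `∂ₜΓ(0) = d · (-Γ₁(0), Γ₀(0), 0)` for some `d ≠ 0` — the vector
`∂ₜΓ(0)` is non-zero, horizontal (`∂ₜΓ₂(0) = 0`) and orthogonal to the unit vector
`Γ(0) = (Γ₀(0), Γ₁(0), 0)`. [folklore] -/
theorem fderiv_single_zero_eq_smul (hΓ : ContDiffAt ℝ 2 Γ 0)
    (hS : ∀ᶠ y in 𝓝 (0 : EuclideanSpace ℝ (Fin 2)), ‖Γ y‖ = 1)
    (hE : ∀ᶠ t in 𝓝 (0 : ℝ), Γ (t • EuclideanSpace.single (0 : Fin 2) (1 : ℝ)) 2 = 0)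
    (hinj : Injective (fderiv ℝ Γ 0)) :
    ∃ d : ℝ, d ≠ 0 ∧ fderiv ℝ Γ 0 (EuclideanSpace.single (0 : Fin 2) (1 : ℝ)) =
      d • (WithLp.toLp 2 ![-(Γ 0 1), Γ 0 0, 0] : EuclideanSpace ℝ (Fin 3)) := by
  set e₀ : EuclideanSpace ℝ (Fin 2) := EuclideanSpace.single (0 : Fin 2) (1 : ℝ) with he₀
  set w : EuclideanSpace ℝ (Fin 3) := fderiv ℝ Γ 0 e₀ with hw
  have htan := inner_fderiv_eq_zero hS (hΓ.differentiableAt (by simp)) e₀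
  have hw2 : w 2 = 0 := fderiv_single_zero_two hΓ hE
  rw [BandFoliation.inner_eq_three, ← hw, hw2, mul_zero, add_zero] at htan
  have h2 := apply_zero_two hE
  have hnorm : ‖Γ 0‖ = 1 := hS.self_of_nhds
  have hsq : Γ 0 0 ^ 2 + Γ 0 1 ^ 2 = 1 := by
    have h1 : ‖Γ 0‖ ^ 2 = 1 := by rw [hnorm, one_pow]
    rw [← real_inner_self_eq_norm_sq, BandFoliation.inner_eq_three, h2] at h1
    nlinarith [h1]
  set d : ℝ := -(Γ 0 1) * w 0 + Γ 0 0 * w 1 with hd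
  have hw0 : w 0 = d * (-(Γ 0 1)) := by
    rw [hd]
    linear_combination Γ 0 0 * htan - w 0 * hsq
  have hw1 : w 1 = d * Γ 0 0 := by
    rw [hd]
    linear_combination Γ 0 1 * htan - w 1 * hsq
  refine ⟨d, ?_, ?_⟩
  · intro hd0
    have hz : w = 0 := by
      ext i
      fin_cases i
      · simp [hw0, hd0]
      · simp [hw1, hd0]
      · simpa using hw2
    have he : e₀ = 0 := hinj (by rw [map_zero, ← hw, hz])
    have := congrArg (fun v : EuclideanSpace ℝ (Fin 2) => v 0) he
    simp [he₀] at this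
  · ext i
    fin_cases i
    · simp [hw0]
    · simp [hw1, mul_comm]
    · simpa using hw2

end SphereGerm

namespace IsSimplifiedBrokenLefschetzFibration

open SphereHeight

variable {X : Type u} [TopologicalSpace X] [ChartedSpace (EuclideanSpace ℝ (Fin 4)) X]
  [IsManifold (𝓡 4) ∞ X] {o : SmoothOrientation (𝓡 4) X}
  {f : X → (Metric.sphere (0 : EuclideanSpace ℝ (Fin 3)) 1)} {L : Finset X} {h : ℕ}

/-! ### Which heights are critical at a round point -/

/-- **A round point `q` is critical for the height `⟪a, ·⟫ ∘ f` iff `a` is orthogonal to the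
tangent `T = (-(f q)₁, (f q)₀, 0)` of the equator at `f q`**, i.e. iff `a₁ (f q)₀ = a₀ (f q)₁`
(SBLF with equatorial round image, any `a ∈ ℝ³`).  In a fold chart only the derivative of the
height ALONG the round image matters (`isMCriticalPt_comp_iff_of_fold_chart`), and that
derivative is `⟪a, ∂ₜΓ(0)⟫ = d ⟪a, T⟫`, `d ≠ 0` (`SphereGerm.fderiv_single_zero_eq_smul`).  The
case `a = (a₀, 0, a₂)` is the tree's `isMCriticalPt_height_comp_iff_of_round`.
[cite: Milnor1963, §2] [cite: Hayano2011, Def. 2.1 (4)] -/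
theorem isMCriticalPt_height_comp_iff_of_round_of_equator
    (hf : IsSimplifiedBrokenLefschetzFibration o f L h)
    (hround : f '' ({p : X | ¬ Surjective (mfderiv (𝓡 4) (𝓡 2) f p)} \ (↑L : Set X)) =
      sphereEquator 1)
    {q : X} (hqs : ¬ Surjective (mfderiv (𝓡 4) (𝓡 2) f q)) (hqL : q ∉ L)
    (a : EuclideanSpace ℝ (Fin 3)) :
    IsMCriticalPt (𝓡 4) (height a ∘ f) q ↔
      a 1 * (f q : EuclideanSpace ℝ (Fin 3)) 0 = a 0 * (f q : EuclideanSpace ℝ (Fin 3)) 1 := by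
  obtain ⟨φ, ψ, hq, hq0, hmaps, hφ, hφs, hψ, hψs, hmodel⟩ := hf.fold q hqs hqL
  obtain ⟨hΓ, hS, hE, hinj, hΓ0⟩ :=
    hf.sphereGerm_of_fold_chart hround hq hq0 hmaps hφ hφs hψ hψs hmodel
  obtain ⟨d, hd, hw⟩ := SphereGerm.fderiv_single_zero_eq_smul hΓ hS hE hinj
  have haxis : (φ q) 1 = 0 ∧ (φ q) 2 = 0 ∧ (φ q) 3 = 0 := by rw [hq0]; simp
  rw [isMCriticalPt_comp_iff_of_fold_chart hmaps hφ hφs hψs hmodel hf.contMDiff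
    (contMDiff_height a) hq haxis, base_apply_eq_zero_of_fold_chart hmodel hq hq0,
    height_comp_symm_eq, fderiv_inner_comp_apply a (hΓ.differentiableAt (by simp)), hw,
    inner_smul_right, mul_eq_zero, BandFoliation.inner_eq_three, hΓ0]
  simp only [hd, false_or, Matrix.cons_val_zero, Matrix.cons_val_one, Matrix.cons_val_two,
    Matrix.head_cons, Matrix.tail_cons, mul_neg, mul_zero, add_zero]
  constructor <;> intro h1 <;> linarith

/-- **The tangential height is regular along the round locus.**  At a round point `q` of an
SBLF with equatorial round image, the height in the direction of the unit tangent
`T = (-(f q)₁, (f q)₀, 0)` of the equator at `f q` is NOT critical: `d(⟪T, ·⟫ ∘ f)_q ≠ 0`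
(`isMCriticalPt_height_comp_iff_of_round_of_equator` with `⟪T, T⟫ = (f q)₀² + (f q)₁² = 1`).
So the meridians of `S²` are transverse to `f` along the round circle.
[cite: Hayano2011, Def. 2.1 (4)] [cite: BaykurKamada2015, §2] -/
theorem not_isMCriticalPt_tangentHeight_comp_of_round
    (hf : IsSimplifiedBrokenLefschetzFibration o f L h)
    (hround : f '' ({p : X | ¬ Surjective (mfderiv (𝓡 4) (𝓡 2) f p)} \ (↑L : Set X)) =
      sphereEquator 1)
    {q : X} (hqs : ¬ Surjective (mfderiv (𝓡 4) (𝓡 2) f q)) (hqL : q ∉ L) :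
    ¬ IsMCriticalPt (𝓡 4)
      (height (WithLp.toLp 2 ![-(f q : EuclideanSpace ℝ (Fin 3)) 1,
        (f q : EuclideanSpace ℝ (Fin 3)) 0, 0] : EuclideanSpace ℝ (Fin 3)) ∘ f) q := by
  rw [hf.isMCriticalPt_height_comp_iff_of_round_of_equator hround hqs hqL]
  set y : EuclideanSpace ℝ (Fin 3) := (f q : EuclideanSpace ℝ (Fin 3)) with hy
  have hmem : f q ∈ sphereEquator 1 := by
    rw [← hround]
    exact ⟨q, ⟨hqs, by simpa using hqL⟩, rfl⟩
  have h2 : y 2 = 0 := (mem_sphereEquator_iff (f q)).1 hmem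
  have hnorm : ‖y‖ = 1 := norm_eq_of_mem_sphere (f q)
  have hsq : y 0 ^ 2 + y 1 ^ 2 = 1 := by
    have h1 : ‖y‖ ^ 2 = 1 := by rw [hnorm, one_pow]
    rw [← real_inner_self_eq_norm_sq, BandFoliation.inner_eq_three, h2] at h1
    nlinarith [h1]
  have e0 : (WithLp.toLp 2 ![-y 1, y 0, (0 : ℝ)] : EuclideanSpace ℝ (Fin 3)) 0 = -y 1 := by simp
  have e1 : (WithLp.toLp 2 ![-y 1, y 0, (0 : ℝ)] : EuclideanSpace ℝ (Fin 3)) 1 = y 0 := by simp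
  rw [e0, e1]
  intro h1
  nlinarith [hsq, h1, sq_nonneg (y 0), sq_nonneg (y 1)]

/-! ### The round locus is an embedded circle parametrised by longitude -/

/-- **The round locus of an SBLF is a smoothly embedded circle, parametrised by the longitude of
its image.**  Let `f : X → S²` be an SBLF on a closed 4-manifold with round image the equator
`E`.  Then there is a `C^∞` embedding `e : S¹ ↪ X` whose range is the round locus
`Z = {df not onto} ∖ L` and with `f (e u) = (u₀, u₁, 0)` (`sphereInclusion 1 2 u`) for all
`u ∈ S¹`.  Construction: `f` is injective on the critical set (Hayano 2011, Def. 2.1 (5)) and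
`f(Z) = E`, so `e := (f|_Z)⁻¹ ∘ (equator)` is a well defined bijection `S¹ → Z`; it is
continuous since `f|_Z` is a closed embedding of the compact `Z`; in a fold chart `(φ, ψ)` at
`e u₀` (Def. 2.1 (4): `Z` is the axis `{x = 0}` and `(ψ ∘ f)₀ = φ₀`) it reads
`u ↦ φ⁻¹ ((ψ (u₀, u₁, 0))₀, 0, 0, 0)`, hence is `C^∞`; `f ∘ e` is the equatorial embedding,
so `de` is injective; and an injective immersion of the compact `S¹` is an embedding (Hirsch
1976, Ch. 1 §3 Thm. 3.1, `isSmoothEmbedding_of_injective_of_injective_mfderiv`).  This is the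
smooth form of Baykur–Kamada 2015, §2–§3 (*"the round singular circle"*, whose image is an
embedded circle). [cite: BaykurKamada2015, §3] [cite: Hayano2011, Def. 2.1 (4), (5)]
[cite: HirschDT1976, Ch. 1 §3 Thm. 3.1] -/
theorem exists_isSmoothEmbedding_range_eq_round [T2Space X] [CompactSpace X]
    (hf : IsSimplifiedBrokenLefschetzFibration o f L h)
    (hround : f '' ({p : X | ¬ Surjective (mfderiv (𝓡 4) (𝓡 2) f p)} \ (↑L : Set X)) =
      sphereEquator 1) :
    ∃ e : Metric.sphere (0 : EuclideanSpace ℝ (Fin 2)) 1 → X,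
      Manifold.IsSmoothEmbedding (𝓡 1) (𝓡 4) ∞ e ∧
      range e = {p : X | ¬ Surjective (mfderiv (𝓡 4) (𝓡 2) f p)} \ (↑L : Set X) ∧
      ∀ u, f (e u) = sphereInclusion 1 2 one_le_two u := by
  set Z : Set X := {p : X | ¬ Surjective (mfderiv (𝓡 4) (𝓡 2) f p)} \ (↑L : Set X) with hZ
  set E : Metric.sphere (0 : EuclideanSpace ℝ (Fin 2)) 1 →
      Metric.sphere (0 : EuclideanSpace ℝ (Fin 3)) 1 := sphereInclusion 1 2 one_le_two with hEdef
  have hEemb : Manifold.IsSmoothEmbedding (𝓡 1) (𝓡 2) ∞ E :=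
    isSmoothEmbedding_sphereInclusion_holds one_le_two
  have hEinj : Injective E := sphereInclusion_injective 1 2 one_le_two
  have hfd : ∀ x, MDifferentiableAt (𝓡 4) (𝓡 2) f x := fun x =>
    (hf.contMDiff x).mdifferentiableAt (by simp)
  -- the round point over an equatorial value
  have hex : ∀ u : Metric.sphere (0 : EuclideanSpace ℝ (Fin 2)) 1, ∃ z ∈ Z, f z = E u :=
      fun u => by
    have hu : E u ∈ f '' Z := by
      rw [hround]
      exact ⟨u, rfl⟩
    obtain ⟨z, hz, hzu⟩ := hu
    exact ⟨z, hz, hzu⟩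
  choose e he heE using hex
  have hinjZ : InjOn f Z := hf.injOn_crit.mono Set.sdiff_subset
  have heinj : Injective e := fun u v huv => hEinj (by rw [← heE u, ← heE v, huv])
  have hrange : range e = Z := by
    refine subset_antisymm ?_ fun z hz => ?_
    · rintro _ ⟨u, rfl⟩
      exact he u
    · have hzE : f z ∈ sphereEquator 1 := hround ▸ mem_image_of_mem f hz
      obtain ⟨u, hu⟩ := hzE
      refine ⟨u, hinjZ (he u) hz ?_⟩
      rw [heE u]
      exact hu
  -- continuity: `f|_Z` is a closed embedding of the compact `Z`
  have hcont : Continuous e := by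
    haveI : CompactSpace ↥Z := isCompact_iff_compactSpace.1 hf.isCompact_round
    have hfc : Continuous (Z.restrict f) := hf.contMDiff.continuous.comp continuous_subtype_val
    have hce : Topology.IsClosedEmbedding (Z.restrict f) := hfc.isClosedEmbedding hinjZ.injective
    let e' : (Metric.sphere (0 : EuclideanSpace ℝ (Fin 2)) 1) → ↥Z := fun u => ⟨e u, he u⟩
    have hfe' : Continuous (Z.restrict f ∘ e') := by
      have heq : Z.restrict f ∘ e' = E := funext fun u => heE u
      rw [heq]
      exact hEemb.contMDiff.continuous
    have he' : Continuous e' := hce.isEmbedding.continuous_iff.2 hfe'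
    exact continuous_subtype_val.comp he'
  -- smoothness, in fold charts
  have hsmooth : ContMDiff (𝓡 1) (𝓡 4) ∞ e := fun u₀ => by
    obtain ⟨φ, ψ, hq, hq0, hmaps, hφ, hφs, hψ, hψs, hmodel⟩ :=
      hf.fold (e u₀) (he u₀).1 fun hL => (he u₀).2 (Finset.mem_coe.2 hL)
    have hEu₀ : E u₀ ∈ ψ.source := heE u₀ ▸ hmaps hq
    -- the chart expression of `e`
    set g : Metric.sphere (0 : EuclideanSpace ℝ (Fin 2)) 1 → EuclideanSpace ℝ (Fin 4) :=
      fun u => ((ψ (E u)) 0) • EuclideanSpace.single (0 : Fin 4) (1 : ℝ) with hg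
    have hφe : ∀ u, e u ∈ φ.source → φ (e u) = g u := fun u hu => by
      have hax : (φ (e u)) 1 = 0 ∧ (φ (e u)) 2 = 0 ∧ (φ (e u)) 3 = 0 := by
        by_contra hne
        exact (he u).1 ((surjective_mfderiv_iff_of_fold_chart hmaps (hφ.of_le (by norm_cast))
          (hφs.of_le (by norm_cast)) (hψ.of_le (by norm_cast)) (hψs.of_le (by norm_cast))
          hmodel hu (hfd (e u))).2 hne)
      have h0 : (φ (e u)) 0 = (ψ (E u)) 0 := by
        rw [← heE u]
        exact ((hmodel _ hu).1).symm
      ext i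
      fin_cases i
      · simpa [hg] using h0
      · simpa [hg] using hax.1
      · simpa [hg] using hax.2.1
      · simpa [hg] using hax.2.2
    have hev : ∀ᶠ u in 𝓝 u₀, e u ∈ φ.source :=
      hcont.continuousAt.preimage_mem_nhds (φ.open_source.mem_nhds hq)
    have hformula : e =ᶠ[𝓝 u₀] (φ.symm ∘ g) := by
      filter_upwards [hev] with u hu
      rw [comp_apply, ← hφe u hu, φ.left_inv hu]
    -- the chart expression is smooth
    have hψE : ContMDiffAt (𝓡 1) (𝓡 2) ∞ (ψ ∘ E) u₀ :=
      ((hψ _ hEu₀).contMDiffAt (ψ.open_source.mem_nhds hEu₀)).comp u₀ (hEemb.contMDiff u₀)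
    have hcoord : ContMDiffAt (𝓡 1) 𝓘(ℝ, ℝ) ∞ (fun u => (ψ (E u)) 0) u₀ :=
      ((EuclideanSpace.proj (𝕜 := ℝ) (0 : Fin 2)).contMDiff.contMDiffAt).comp u₀ hψE
    have hgs : ContMDiffAt (𝓡 1) 𝓘(ℝ, EuclideanSpace ℝ (Fin 4)) ∞ g u₀ :=
      hcoord.smul contMDiffAt_const
    have hgt : g u₀ ∈ φ.target := by
      rw [← hφe u₀ hq]
      exact φ.map_source hq
    have hcomp : ContMDiffAt (𝓡 1) (𝓡 4) ∞ (φ.symm ∘ g) u₀ :=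
      ((hφs _ hgt).contMDiffAt (φ.open_target.mem_nhds hgt)).comp u₀ hgs
    exact hcomp.congr_of_eventuallyEq hformula
  -- injectivity of the differential: `f ∘ e` is the equatorial embedding
  have hde : ∀ u, Injective (mfderiv (𝓡 1) (𝓡 4) e u) := fun u => by
    obtain ⟨F, _, _, hF⟩ := hEemb.isImmersion
    have hEd : Injective (mfderiv (𝓡 1) (𝓡 2) E u) :=
      Manifold.IsImmersionAtOfComplement.mfderiv_injective (hF u) (by simp)
    have hfe : f ∘ e = E := funext heE
    have hed : MDifferentiableAt (𝓡 1) (𝓡 4) e u := (hsmooth u).mdifferentiableAt (by simp)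
    have h1 : HasMFDerivAt (𝓡 1) (𝓡 2) (f ∘ e) u
        ((mfderiv (𝓡 4) (𝓡 2) f (e u)).comp (mfderiv (𝓡 1) (𝓡 4) e u)) :=
      (hfd (e u)).hasMFDerivAt.comp u hed.hasMFDerivAt
    have h2 : HasMFDerivAt (𝓡 1) (𝓡 2) E u
        ((mfderiv (𝓡 4) (𝓡 2) f (e u)).comp (mfderiv (𝓡 1) (𝓡 4) e u)) := hfe ▸ h1
    have key : ∀ v, mfderiv (𝓡 1) (𝓡 2) E u v =
        mfderiv (𝓡 4) (𝓡 2) f (e u) (mfderiv (𝓡 1) (𝓡 4) e u v) := fun v => by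
      rw [h2.mfderiv]
      rfl
    intro v w hvw
    apply hEd
    rw [key, key, hvw]
  have h1le : (1 : ℕ∞ω) ≤ ∞ := by exact_mod_cast le_top
  exact ⟨e, isSmoothEmbedding_of_injective_of_injective_mfderiv hsmooth h1le heinj hde,
    hrange, heE⟩

end IsSimplifiedBrokenLefschetzFibration

end Literature.Topology.FourManifolds
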